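import Literature.NumberTheory.Sieve.BatemanHornProofs
import Literature.NumberTheory.Sieve.MoebiusShiftedPrimesSieveBound
import Literature.NumberTheory.Sieve.AletheiaZomleferFukshanskyGarcia2020ApplicationsBrunSieveProofs
import HarnessLib

/-!
# The sieve product of a Bateman–Horn system: `V(x^c) ≤ K/(log x)^k` eventually

Route `RoughValueTransport`, crux `BalancedSemiprimeLayer` (item stmt-Parity-9469), line
`rough-relaxed-divisor-sieve` (companion lead c1): anchor D `stub_densityProduct_le` of the
skeleton `Lines/rough_relaxed_divisor_sieve_c1.lean`.

For a Bateman–Horn system `f = (f₀, …, f_{k−1})` with local root counts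
`ρ_F(p) = polyRootCountMod f p` and every exponent `c > 0` there is `K > 0` (depending on `f`
and `c` only) with `∏_{p < ⌈x^c⌉} (1 − ρ_F(p)/p) ≤ K/(log x)^k` for all large `x ∈ ℕ`.

Proof.  `∏_{p ≤ y} (1 − ρ_F(p)/p) = BHP_f(y) · (∏_{p ≤ y} (1 − 1/p))^k`
(`PolyPrimeCountBrun.prod_one_sub_rootCount_eq`) with
`BHP_f(y) = batemanHornPartial f y → C_f > 0` (`exists_hasBatemanHornConst_holds`), so
`BHP_f(y) ≤ 2 C_f` for `y` large; Mertens in upper-bound form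
(`Lichtman2020.prod_primesLE_one_sub_inv_le`: `∏_{p ≤ y} (1 − 1/p) ≤ e^{6/log 2} log 2/log y`
for `y ≥ 2`); and with `y = ⌈x^c⌉ − 1 ≥ x^{c/2}` one has `log y ≥ (c/2) log x` for `x` large,
whence `K = 2 C_f (2 e^{6/log 2} log 2/c)^k`.
-/

noncomputable section

open Polynomial Filter Finset
open Literature.NumberTheory.Sieve

namespace Summit.Parity.BatemanHorn.Cruxes.BalancedSemiprimeLayer.RoughRelaxedDivisorSieve

namespace DensityProduct

/-- For `y ≥ 2` with `BHP_f(y) ≤ 2 C_f` (`C_f ≥ 0`):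
`∏_{p ≤ y} (1 − ρ_F(p)/p) ≤ 2 C_f · (e^{6/log 2} log 2/log y)^k`. [folklore] -/
theorem prod_one_sub_le {k : ℕ} (f : Fin k → ℤ[X]) {y : ℕ} (hy : 2 ≤ y) {Cf : ℝ}
    (hB : batemanHornPartial f y ≤ 2 * Cf) (hCf : 0 ≤ Cf) :
    ∏ p ∈ Nat.primesLE y, (1 - (polyRootCountMod f p : ℝ) / p) ≤
      2 * Cf * (Real.exp (6 / Real.log 2) * (Real.log 2 / Real.log y)) ^ k := by
  rw [PolyPrimeCountBrun.prod_one_sub_rootCount_eq]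
  have hM0 : 0 ≤ ∏ p ∈ Nat.primesLE y, (1 - 1 / (p : ℝ)) := Finset.prod_nonneg fun p hp => by
    have hp2 : (2 : ℝ) ≤ p := by exact_mod_cast (Nat.prime_of_mem_primesLE hp).two_le
    have : (1 : ℝ) / p ≤ 1 / 2 := one_div_le_one_div_of_le (by norm_num) hp2
    linarith
  have hM := Lichtman2020.prod_primesLE_one_sub_inv_le hy
  exact mul_le_mul hB (pow_le_pow_left₀ hM0 hM k) (pow_nonneg hM0 k) (by positivity)

/-- **`V(x^c) ≤ K/(log x)^k` eventually** for a Bateman–Horn system `f` and `c > 0`, with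
`K = 2 C_f (2 e^{6/log 2} log 2/c)^k`. [folklore] -/
theorem densityProduct_le {k : ℕ} {f : Fin k → ℤ[X]} (hf : IsBatemanHornSystem f) {c : ℝ}
    (hc : 0 < c) :
    ∃ K : ℝ, 0 < K ∧ ∀ᶠ x : ℕ in atTop,
      (∏ p ∈ Nat.primesBelow ⌈(x : ℝ) ^ c⌉₊, (1 - (polyRootCountMod f p : ℝ) / p)) ≤
        K / Real.log x ^ k := by
  obtain ⟨Cf, hCf0, hCf⟩ := exists_hasBatemanHornConst_holds (ι := Fin k) hf
  have hl2 : 0 < Real.log 2 := Real.log_pos one_lt_two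
  refine ⟨2 * Cf * (2 * (Real.exp (6 / Real.log 2) * Real.log 2) / c) ^ k, by positivity, ?_⟩
  -- `BHP_f(y) ≤ 2 C_f` for `y ≥ y₀`
  have h1 : ∀ᶠ y : ℕ in atTop, batemanHornPartial f y ≤ 2 * Cf :=
    Filter.Tendsto.eventually_le_const (show Cf < 2 * Cf by linarith) hCf
  obtain ⟨y₀, hy₀⟩ := eventually_atTop.1 h1
  -- `x^{c/2} ≥ max(2, y₀)` for `x` large
  have h2 : ∀ᶠ x : ℝ in atTop, max 2 (y₀ : ℝ) ≤ x ^ (c / 2) :=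
    (tendsto_rpow_atTop (by positivity)).eventually_ge_atTop _
  filter_upwards [tendsto_natCast_atTop_atTop.eventually h2, eventually_gt_atTop 1] with x hx hx1
  have hx' : max 2 (y₀ : ℝ) ≤ (x : ℝ) ^ (c / 2) := hx
  have hX1 : (1 : ℝ) < x := by exact_mod_cast hx1
  have hX0 : (0 : ℝ) < x := by linarith
  have hlogX : 0 < Real.log x := Real.log_pos hX1
  -- `t = x^{c/2}`
  set t : ℝ := (x : ℝ) ^ (c / 2) with ht
  have ht2 : 2 ≤ t := le_trans (le_max_left _ _) hx'
  have hty₀ : (y₀ : ℝ) ≤ t := le_trans (le_max_right _ _) hx'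
  have ht0 : 0 < t := by linarith
  have htz : t * t = (x : ℝ) ^ c := by
    rw [ht, ← Real.rpow_add hX0]; congr 1; ring
  have hlogt : Real.log t = c / 2 * Real.log x := by rw [ht, Real.log_rpow hX0]
  have h2t : 2 * t ≤ t * t := mul_le_mul_of_nonneg_right ht2 ht0.le
  -- `y = ⌈x^c⌉ − 1 ≥ t`
  have hceil : t * t ≤ (⌈(x : ℝ) ^ c⌉₊ : ℝ) := by rw [htz]; exact Nat.le_ceil _
  have hceil1 : 1 ≤ ⌈(x : ℝ) ^ c⌉₊ := by
    have : (1 : ℝ) ≤ (⌈(x : ℝ) ^ c⌉₊ : ℝ) := by linarith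
    exact_mod_cast this
  rw [Nat.primesBelow_eq_primesLE_sub_one]
  set y : ℕ := ⌈(x : ℝ) ^ c⌉₊ - 1 with hy
  have hyr : (y : ℝ) = (⌈(x : ℝ) ^ c⌉₊ : ℝ) - 1 := by
    rw [hy, Nat.cast_sub hceil1, Nat.cast_one]
  have hty : t ≤ (y : ℝ) := by rw [hyr]; linarith
  have hy2 : 2 ≤ y := by
    have : (2 : ℝ) ≤ (y : ℝ) := ht2.trans hty
    exact_mod_cast this
  have hyy₀ : y₀ ≤ y := by
    have : (y₀ : ℝ) ≤ (y : ℝ) := hty₀.trans hty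
    exact_mod_cast this
  have hlogy : c / 2 * Real.log x ≤ Real.log y := by
    rw [← hlogt]; exact Real.log_le_log ht0 hty
  have hclog : 0 < c / 2 * Real.log x := by positivity
  -- the bound
  calc ∏ p ∈ Nat.primesLE y, (1 - (polyRootCountMod f p : ℝ) / p)
      ≤ 2 * Cf * (Real.exp (6 / Real.log 2) * (Real.log 2 / Real.log y)) ^ k :=
        prod_one_sub_le f hy2 (hy₀ y hyy₀) hCf0.le
    _ ≤ 2 * Cf * (Real.exp (6 / Real.log 2) * (Real.log 2 / (c / 2 * Real.log x))) ^ k := by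
        have hle : Real.log 2 / Real.log y ≤ Real.log 2 / (c / 2 * Real.log x) :=
          div_le_div_of_nonneg_left hl2.le hclog hlogy
        have h0 : 0 ≤ Real.exp (6 / Real.log 2) * (Real.log 2 / Real.log y) := by positivity
        exact mul_le_mul_of_nonneg_left
          (pow_le_pow_left₀ h0 (mul_le_mul_of_nonneg_left hle (Real.exp_pos _).le) k)
          (by positivity)
    _ = 2 * Cf * (2 * (Real.exp (6 / Real.log 2) * Real.log 2) / c) ^ k / Real.log x ^ k := by
        rw [mul_div_assoc, ← div_pow]
        congr 2
        field_simp

end DensityProduct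

/-- **Anchor D `stub_densityProduct_le`** — `V(x^c) = ∏_{p < ⌈x^c⌉}(1 − ρ_F(p)/p) ≤ K/(log x)^k`
eventually in `x ∈ ℕ`, for a Bateman–Horn system `f` and `c > 0`, `K` depending on `f` and `c`
only (`(∏_{p ≤ y}(1 − 1/p))^k · BHP_f(y) ≤ (e^{6/log 2} log 2/log y)^k · 2C_f`:
`Lichtman2020.prod_primesLE_one_sub_inv_le`, `exists_hasBatemanHornConst_holds`). [folklore] -/
theorem stub_densityProduct_le :
    ∀ (k : ℕ) (f : Fin k → ℤ[X]), IsBatemanHornSystem f → ∀ c : ℝ, 0 < c →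
      ∃ K : ℝ, 0 < K ∧ ∀ᶠ x : ℕ in atTop,
        (∏ p ∈ Nat.primesBelow ⌈(x : ℝ) ^ c⌉₊, (1 - (polyRootCountMod f p : ℝ) / p)) ≤
          K / Real.log x ^ k := by
  intro k f hf c hc
  exact DensityProduct.densityProduct_le hf hc

end Summit.Parity.BatemanHorn.Cruxes.BalancedSemiprimeLayer.RoughRelaxedDivisorSieve

end
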